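import Summits.QuantumFields.YangMills.Theorems.ColdStartUniversalityLatticeLangevinMarkovProperty
import Summits.QuantumFields.YangMills.Theorems.ColdStartUniversalityLatticeLangevinDoeblinHaarAllTimes
import HarnessLib

/-!
# Route `ColdStartUniversality` (fixed-cut-off SZZ dynamics): ★★★ RECURRENCE OF THE COLD-START DYNAMICS —
# every set of positive Haar measure is visited infinitely often almost surely, with geometric avoidance probabilities, from EVERY start

Helper file (seat `ym-line-csu-p1`, g33; `--supports stmt-QuantumFields-24809`).  The Markov property with respect to the driving filtration (file 44)
and the Doeblin–Haar minorisation of THE transition kernels (`doeblin_szz_haar_of_pos`: `c·Haar^E ≤ κ_t(z,·)` for all `z`, all `t ≥ t₀ > 0`, every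
coupling) give, for EVERY strong solution `U` of the SU(2) SZZ dynamics from a deterministic start on ANY probability space:
* ★★ `integral_prod_indicator_compl_le_pow` — generic: if `δ ≤ κ_h(z, A)` for every `z`, then
  `E[∏_(k<n) 1_(Aᶜ)(U_((m+k+1)h))] ≤ (1 − δ)^n` (induction on `n`, the Markov property at time `(m+n)h` with the `𝓕_((m+n)h)`-measurable weight
  `∏_(k<n) 1_(Aᶜ)(U_((m+k+1)h))`);
* ★★★ `measureReal_forall_notMem_le_pow` — **geometric avoidance**: for every `h > 0` there is `c ∈ (0,1]` (depending on `L, β', h`) with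
  `P(U_((m+k+1)h) ∉ A for all k < n) ≤ (1 − c·Haar^E(A))^n` for every measurable `A`, every `m, n`, every start, every realisation;
* ★★★ `ae_frequently_mem` — **recurrence**: if `Haar^E(A) > 0` then almost surely `U_(kh) ∈ A` for infinitely many `k` — the cold-start dynamics
  visits every region of configuration space of positive Haar measure (every non-empty open set) infinitely often.
THEOREMS ONLY, no definition, no sorry; [folklore].  HONEST FRAMING: fixed cut-off; the constant `c` is the Doeblin constant at fixed `(L, β', h)` — no
uniformity in the cut-off; `UniformColdStartMixing` (24809) is NOT restated; no crux, rung or summit statement is proved; the Yang–Mills mass gap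
is NOT proved.
-/

set_option autoImplicit false

noncomputable section

namespace Summit.QuantumFields.YangMills.Theorems.ColdStartUniversality

open MeasureTheory ProbabilityTheory Filter Topology
open scoped NNReal ENNReal BigOperators
open Literature Literature.Probability.Process Literature.MathematicalPhysics.QuantumFieldTheory
open Literature.MathematicalPhysics.QuantumLattice (fundamentalRep fundamentalLatticeRep continuous_fundamentalRep)

variable {L : ℕ} [NeZero L]

/-! ## §1. Geometric decay of avoidance probabilities from a uniform one-step visiting probability -/

/-- ★★ **Avoidance probabilities decay geometrically.**  Let `U` be a strong solution from a deterministic start on any space, `A` measurable,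
`h` a lattice time and `δ ≤ κ_h(z, A)` for every `z` (a uniform one-step visiting probability).  Then for all `m, n`:
`E[∏_(k<n) 1_(Aᶜ)(U_((m+k+1)h))] ≤ (1 − δ)^n`. [folklore] -/
theorem integral_prod_indicator_compl_le_pow (β' : ℝ)
    (κ : ℝ≥0 → Kernel (GaugeConfig 3 L (Matrix.specialUnitaryGroup (Fin 2) ℂ))
      (GaugeConfig 3 L (Matrix.specialUnitaryGroup (Fin 2) ℂ))) [∀ t, IsMarkovKernel (κ t)]
    (hreal : ∀ (t : ℝ≥0) (x : GaugeConfig 3 L (Matrix.specialUnitaryGroup (Fin 2) ℂ))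
        (Ω : Type) [MeasurableSpace Ω] (P : Measure Ω) [IsProbabilityMeasure P]
        (W : ℝ≥0 → Ω → (Edge 3 L × NoiseIdx 2 → ℝ)) (hW : IsFlatBrownian W P)
        (U : ℝ≥0 → Ω → GaugeConfig 3 L (Matrix.specialUnitaryGroup (Fin 2) ℂ)),
        (∀ ω, U 0 ω = x) →
        (latticeLangevinDynamics (fundamentalLatticeRep 2) β').IsSolution (fundamentalRep (Fin 2))
          hW.natFiltration P W U →
        κ t x = P.map (U t))
    (x : GaugeConfig 3 L (Matrix.specialUnitaryGroup (Fin 2) ℂ))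
    {Ω : Type} [MeasurableSpace Ω] {P : Measure Ω} [IsProbabilityMeasure P]
    {W : ℝ≥0 → Ω → (Edge 3 L × NoiseIdx 2 → ℝ)} (hW : IsFlatBrownian W P)
    {U : ℝ≥0 → Ω → GaugeConfig 3 L (Matrix.specialUnitaryGroup (Fin 2) ℂ)} (hU0 : ∀ ω, U 0 ω = x)
    (hU : (latticeLangevinDynamics (fundamentalLatticeRep 2) β').IsSolution (fundamentalRep (Fin 2)) hW.natFiltration P W U)
    {A : Set (GaugeConfig 3 L (Matrix.specialUnitaryGroup (Fin 2) ℂ))} (hA : MeasurableSet A) (h : ℝ≥0) {δ : ℝ}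
    (hδ : ∀ z, δ ≤ ((κ h z) A).toReal) (m : ℕ) :
    ∀ n : ℕ, ∫ ω, (∏ k ∈ Finset.range n, Aᶜ.indicator (fun _ => (1 : ℝ)) (U (((m + k + 1 : ℕ) : ℝ≥0) * h) ω)) ∂P ≤ (1 - δ) ^ n
  | 0 => by simp
  | n + 1 => by
    classical
    have ih := integral_prod_indicator_compl_le_pow β' κ hreal x hW hU0 hU hA h hδ m n
    -- the weight `Z_n = ∏_(k<n) 1_(Aᶜ)(U_((m+k+1)h))` is `𝓕_((m+n)h)`-measurable, in `[0,1]`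
    have hind1 : ∀ (k : ℕ) ω, 0 ≤ Aᶜ.indicator (fun _ => (1 : ℝ)) (U (((m + k + 1 : ℕ) : ℝ≥0) * h) ω) ∧
        Aᶜ.indicator (fun _ => (1 : ℝ)) (U (((m + k + 1 : ℕ) : ℝ≥0) * h) ω) ≤ 1 := fun k ω => by
      by_cases hk : U (((m + k + 1 : ℕ) : ℝ≥0) * h) ω ∈ Aᶜ
      · rw [Set.indicator_of_mem hk]; exact ⟨zero_le_one, le_rfl⟩
      · rw [Set.indicator_of_notMem hk]; exact ⟨le_rfl, zero_le_one⟩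
    have hZ0 : ∀ ω, 0 ≤ ∏ k ∈ Finset.range n, Aᶜ.indicator (fun _ => (1 : ℝ)) (U (((m + k + 1 : ℕ) : ℝ≥0) * h) ω) := fun ω =>
      Finset.prod_nonneg fun k _ => (hind1 k ω).1
    have hZ1 : ∀ ω, ∏ k ∈ Finset.range n, Aᶜ.indicator (fun _ => (1 : ℝ)) (U (((m + k + 1 : ℕ) : ℝ≥0) * h) ω) ≤ 1 := fun ω =>
      Finset.prod_le_one (fun k _ => (hind1 k ω).1) (fun k _ => (hind1 k ω).2)
    have hZb : ∀ ω, |∏ k ∈ Finset.range n, Aᶜ.indicator (fun _ => (1 : ℝ)) (U (((m + k + 1 : ℕ) : ℝ≥0) * h) ω)| ≤ 1 := fun ω => by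
      rw [abs_of_nonneg (hZ0 ω)]; exact hZ1 ω
    have hZm : Measurable[hW.natFiltration (((m + n : ℕ) : ℝ≥0) * h)]
        fun ω => ∏ k ∈ Finset.range n, Aᶜ.indicator (fun _ => (1 : ℝ)) (U (((m + k + 1 : ℕ) : ℝ≥0) * h) ω) := by
      refine Finset.measurable_prod _ fun k hk => ?_
      have hk' := Finset.mem_range.1 hk
      have hle : (((m + k + 1 : ℕ) : ℝ≥0) * h) ≤ (((m + n : ℕ) : ℝ≥0) * h) :=
        mul_le_mul_of_nonneg_right (by exact_mod_cast (by omega : m + k + 1 ≤ m + n)) (by positivity)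
      exact (measurable_const.indicator hA.compl).comp ((hU.adapted _).mono (hW.natFiltration.mono hle) le_rfl)
    -- the Markov property at time `(m+n)h`
    have hG : Measurable (Aᶜ.indicator fun _ => (1 : ℝ)) := measurable_const.indicator hA.compl
    have hGb : ∀ z, |Aᶜ.indicator (fun _ => (1 : ℝ)) z| ≤ 1 := fun z => by
      by_cases hz : z ∈ Aᶜ
      · rw [Set.indicator_of_mem hz]; simp
      · rw [Set.indicator_of_notMem hz]; simp
    have hM := integral_mul_comp_add_eq_integral_mul_transition β' κ hreal x hW hU0 hU (((m + n : ℕ) : ℝ≥0) * h) h hZm hZb hG hGb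
    -- `κ_h 1_(Aᶜ) ≤ 1 − δ`
    have hκ : ∀ z, ∫ w, Aᶜ.indicator (fun _ => (1 : ℝ)) w ∂(κ h z) ≤ 1 - δ := fun z => by
      rw [show (Aᶜ.indicator fun _ => (1 : ℝ)) = Aᶜ.indicator 1 from rfl, integral_indicator_one hA.compl,
        probReal_compl_eq_one_sub hA]
      linarith [hδ z, measureReal_def (κ h z) A]
    have htime : (((m + n : ℕ) : ℝ≥0) * h) + h = ((m + n + 1 : ℕ) : ℝ≥0) * h := by push_cast; ring
    calc ∫ ω, (∏ k ∈ Finset.range (n + 1), Aᶜ.indicator (fun _ => (1 : ℝ)) (U (((m + k + 1 : ℕ) : ℝ≥0) * h) ω)) ∂P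
        = ∫ ω, (∏ k ∈ Finset.range n, Aᶜ.indicator (fun _ => (1 : ℝ)) (U (((m + k + 1 : ℕ) : ℝ≥0) * h) ω)) *
            Aᶜ.indicator (fun _ => (1 : ℝ)) (U ((((m + n : ℕ) : ℝ≥0) * h) + h) ω) ∂P := by
          refine integral_congr_ae (ae_of_all _ fun ω => ?_)
          simp only [Finset.prod_range_succ, htime]
      _ = ∫ ω, (∏ k ∈ Finset.range n, Aᶜ.indicator (fun _ => (1 : ℝ)) (U (((m + k + 1 : ℕ) : ℝ≥0) * h) ω)) *
            (∫ w, Aᶜ.indicator (fun _ => (1 : ℝ)) w ∂(κ h (U (((m + n : ℕ) : ℝ≥0) * h) ω))) ∂P := hM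
      _ ≤ ∫ ω, (∏ k ∈ Finset.range n, Aᶜ.indicator (fun _ => (1 : ℝ)) (U (((m + k + 1 : ℕ) : ℝ≥0) * h) ω)) * (1 - δ) ∂P := by
          refine integral_mono_of_nonneg (ae_of_all _ fun ω => mul_nonneg (hZ0 ω) (integral_nonneg fun w => ?_)) ?_
            (ae_of_all _ fun ω => mul_le_mul_of_nonneg_left (hκ _) (hZ0 ω))
          · by_cases hw : w ∈ Aᶜ <;> simp [hw]
          · exact ((integrable_const (1 : ℝ)).mono' ((hZm.mono (hW.natFiltration.le _) le_rfl).aestronglyMeasurable)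
              (Eventually.of_forall fun ω => by rw [Real.norm_eq_abs]; exact hZb ω)).mul_const _
      _ = (1 - δ) * ∫ ω, (∏ k ∈ Finset.range n, Aᶜ.indicator (fun _ => (1 : ℝ)) (U (((m + k + 1 : ℕ) : ℝ≥0) * h) ω)) ∂P := by
          rw [integral_mul_const, mul_comm]
      _ ≤ (1 - δ) * (1 - δ) ^ n := by
          have hδ1 : δ ≤ 1 := (hδ x).trans (by rw [← measureReal_def]; exact measureReal_le_one)
          exact mul_le_mul_of_nonneg_left ih (by linarith)
      _ = (1 - δ) ^ (n + 1) := by ring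

/-- The avoidance event is measurable and its probability is the expectation of the product of indicators. [folklore] -/
theorem measureReal_forall_notMem_eq_integral_prod {Ω X : Type*} [MeasurableSpace Ω] [MeasurableSpace X] {P : Measure Ω}
    {V : ℕ → Ω → X} (hV : ∀ k, Measurable (V k)) {A : Set X} (hA : MeasurableSet A) (n : ℕ) :
    MeasurableSet {ω | ∀ k, k < n → V k ω ∉ A} ∧
      P.real {ω | ∀ k, k < n → V k ω ∉ A} = ∫ ω, (∏ k ∈ Finset.range n, Aᶜ.indicator (fun _ => (1 : ℝ)) (V k ω)) ∂P := by
  classical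
  have hS : {ω | ∀ k, k < n → V k ω ∉ A} = ⋂ k ∈ Finset.range n, (V k) ⁻¹' Aᶜ := by
    ext ω; simp [Finset.mem_range]
  have hSm : MeasurableSet {ω | ∀ k, k < n → V k ω ∉ A} := by
    rw [hS]; exact MeasurableSet.biInter (Finset.countable_toSet _) fun k _ => hV k hA.compl
  refine ⟨hSm, ?_⟩
  rw [← integral_indicator_one hSm]
  refine integral_congr_ae (ae_of_all _ fun ω => ?_)
  by_cases hω : ω ∈ {ω | ∀ k, k < n → V k ω ∉ A}
  · rw [Set.indicator_of_mem hω, Pi.one_apply]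
    symm
    refine Finset.prod_eq_one fun k hk => ?_
    rw [Set.indicator_of_mem (show V k ω ∈ Aᶜ from hω k (Finset.mem_range.1 hk))]
  · rw [Set.indicator_of_notMem hω]
    simp only [Set.mem_setOf_eq, not_forall, not_not, exists_prop] at hω
    obtain ⟨k, hk, hkA⟩ := hω
    symm
    exact Finset.prod_eq_zero (Finset.mem_range.2 hk) (by rw [Set.indicator_of_notMem (show V k ω ∉ Aᶜ from fun h => h hkA)])

/-! ## §2. Geometric avoidance and almost-sure recurrence for the SZZ dynamics -/

/-- ★★★ **Geometric avoidance probabilities.**  For every sampling step `h > 0` there is `c ∈ (0, 1]` (the Doeblin–Haar constant of THE kernels at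
`(L, β', h)`) such that for EVERY strong solution `U` from a deterministic start on ANY space, every measurable `A`, and all `m, n`:
`P(U_((m+k+1)h) ∉ A for all k < n) ≤ (1 − c·Haar^E(A))^n`. [folklore] -/
theorem measureReal_forall_notMem_le_pow (L : ℕ) [NeZero L] (β' : ℝ) {h : ℝ≥0} (hh : 0 < (h : ℝ)) :
    ∃ c : ℝ, 0 < c ∧ c ≤ 1 ∧
      ∀ (x : GaugeConfig 3 L (Matrix.specialUnitaryGroup (Fin 2) ℂ))
        (Ω : Type) [MeasurableSpace Ω] (P : Measure Ω) [IsProbabilityMeasure P]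
        (W : ℝ≥0 → Ω → (Edge 3 L × NoiseIdx 2 → ℝ)) (hW : IsFlatBrownian W P)
        (U : ℝ≥0 → Ω → GaugeConfig 3 L (Matrix.specialUnitaryGroup (Fin 2) ℂ)),
        (∀ ω, U 0 ω = x) →
        (latticeLangevinDynamics (fundamentalLatticeRep 2) β').IsSolution (fundamentalRep (Fin 2)) hW.natFiltration P W U →
        ∀ (A : Set (GaugeConfig 3 L (Matrix.specialUnitaryGroup (Fin 2) ℂ))), MeasurableSet A → ∀ (m n : ℕ),
          P.real {ω | ∀ k, k < n → U (((m + k + 1 : ℕ) : ℝ≥0) * h) ω ∉ A} ≤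
            (1 - c * ((Measure.pi fun _ : Edge 3 L => haarProbability (Matrix.specialUnitaryGroup (Fin 2) ℂ)) A).toReal) ^ n := by
  classical
  obtain ⟨κ, hκM, -, hreal⟩ := exists_transitionKernel L β'
  haveI := hκM
  obtain ⟨c, hc, hc1, hmin⟩ := doeblin_szz_haar_of_pos (L := L) β' κ hreal (t₀ := h) hh
  refine ⟨c, hc, hc1, fun x Ω _ P _ W hW U hU0 hU A hA m n => ?_⟩
  have hmU : ∀ u : ℝ≥0, Measurable (U u) := fun u => (hU.adapted u).mono (hW.natFiltration.le u) le_rfl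
  -- the uniform one-step visiting probability `δ = c·Haar(A)`
  have hδ : ∀ z, c * ((Measure.pi fun _ : Edge 3 L => haarProbability (Matrix.specialUnitaryGroup (Fin 2) ℂ)) A).toReal ≤ ((κ h z) A).toReal := by
    intro z
    have h1 := (Measure.le_iff'.1 (hmin z h le_rfl)) A
    rw [Measure.smul_apply, smul_eq_mul] at h1
    have h2 := ENNReal.toReal_mono (measure_ne_top _ _) h1
    rwa [ENNReal.toReal_mul, ENNReal.toReal_ofReal hc.le] at h2
  have hev := measureReal_forall_notMem_eq_integral_prod (P := P) (fun k => hmU (((m + k + 1 : ℕ) : ℝ≥0) * h)) hA n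
  rw [hev.2]
  exact integral_prod_indicator_compl_le_pow β' κ hreal x hW hU0 hU hA h hδ m n

/-- ★★★ **RECURRENCE: every set of positive Haar measure is visited infinitely often, almost surely, from every start.**  For every strong solution
`U` of the SU(2) SZZ dynamics from a deterministic start on any space, every sampling step `h > 0` and every measurable `A` with `Haar^E(A) ≠ 0`:
almost surely `U_(kh) ∈ A` for infinitely many `k`. [folklore] -/
theorem ae_frequently_mem (L : ℕ) [NeZero L] (β' : ℝ)
    (x : GaugeConfig 3 L (Matrix.specialUnitaryGroup (Fin 2) ℂ))
    {Ω : Type} [MeasurableSpace Ω] {P : Measure Ω} [IsProbabilityMeasure P]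
    {W : ℝ≥0 → Ω → (Edge 3 L × NoiseIdx 2 → ℝ)} (hW : IsFlatBrownian W P)
    {U : ℝ≥0 → Ω → GaugeConfig 3 L (Matrix.specialUnitaryGroup (Fin 2) ℂ)} (hU0 : ∀ ω, U 0 ω = x)
    (hU : (latticeLangevinDynamics (fundamentalLatticeRep 2) β').IsSolution (fundamentalRep (Fin 2)) hW.natFiltration P W U)
    {h : ℝ≥0} (hh : 0 < (h : ℝ)) {A : Set (GaugeConfig 3 L (Matrix.specialUnitaryGroup (Fin 2) ℂ))} (hA : MeasurableSet A)
    (hHaar : (Measure.pi fun _ : Edge 3 L => haarProbability (Matrix.specialUnitaryGroup (Fin 2) ℂ)) A ≠ 0) :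
    ∀ᵐ ω ∂P, ∃ᶠ k : ℕ in atTop, U ((k : ℝ≥0) * h) ω ∈ A := by
  classical
  obtain ⟨c, hc, hc1, hbound⟩ := measureReal_forall_notMem_le_pow L β' hh
  set q : ℝ := 1 - c * ((Measure.pi fun _ : Edge 3 L => haarProbability (Matrix.specialUnitaryGroup (Fin 2) ℂ)) A).toReal with hq
  haveI : IsProbabilityMeasure (Measure.pi fun _ : Edge 3 L => haarProbability (Matrix.specialUnitaryGroup (Fin 2) ℂ)) := by infer_instance
  have hHpos : 0 < ((Measure.pi fun _ : Edge 3 L => haarProbability (Matrix.specialUnitaryGroup (Fin 2) ℂ)) A).toReal :=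
    ENNReal.toReal_pos hHaar (measure_ne_top _ _)
  have hH1 : ((Measure.pi fun _ : Edge 3 L => haarProbability (Matrix.specialUnitaryGroup (Fin 2) ℂ)) A).toReal ≤ 1 := by
    rw [← measureReal_def]; exact measureReal_le_one
  have hq0 : 0 ≤ q := by rw [hq]; nlinarith
  have hq1 : q < 1 := by rw [hq]; nlinarith
  have hqlim : Tendsto (fun n : ℕ => q ^ n) atTop (𝓝 0) := tendsto_pow_atTop_nhds_zero_of_lt_one hq0 hq1
  have hmU : ∀ u : ℝ≥0, Measurable (U u) := fun u => (hU.adapted u).mono (hW.natFiltration.le u) le_rfl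
  -- the "eventually avoids `A` after time `m h`" events are null
  have hnull : ∀ m : ℕ, P {ω | ∀ k, m < k → U ((k : ℝ≥0) * h) ω ∉ A} = 0 := by
    intro m
    have hle : ∀ n : ℕ, P.real {ω | ∀ k, m < k → U ((k : ℝ≥0) * h) ω ∉ A} ≤ q ^ n := by
      intro n
      have hsub : {ω | ∀ k, m < k → U ((k : ℝ≥0) * h) ω ∉ A} ⊆ {ω | ∀ k, k < n → U (((m + k + 1 : ℕ) : ℝ≥0) * h) ω ∉ A} := by
        intro ω hω k _
        exact hω (m + k + 1) (by omega)
      exact le_trans (measureReal_mono hsub) (hbound x Ω P W hW U hU0 hU A hA m n)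
    have h0 : P.real {ω | ∀ k, m < k → U ((k : ℝ≥0) * h) ω ∉ A} ≤ 0 :=
      ge_of_tendsto' hqlim hle
    have h00 : P.real {ω | ∀ k, m < k → U ((k : ℝ≥0) * h) ω ∉ A} = 0 := le_antisymm h0 measureReal_nonneg
    exact (measureReal_eq_zero_iff (measure_ne_top _ _)).1 h00
  have hN : P {ω | ¬ ∃ᶠ k : ℕ in atTop, U ((k : ℝ≥0) * h) ω ∈ A} = 0 := by
    have hsub : {ω | ¬ ∃ᶠ k : ℕ in atTop, U ((k : ℝ≥0) * h) ω ∈ A} ⊆ ⋃ m : ℕ, {ω | ∀ k, m < k → U ((k : ℝ≥0) * h) ω ∉ A} := by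
      intro ω hω
      simp only [Filter.not_frequently, Filter.eventually_atTop, Set.mem_setOf_eq] at hω
      obtain ⟨m, hm⟩ := hω
      exact Set.mem_iUnion.2 ⟨m, fun k hk => hm k hk.le⟩
    exact measure_mono_null hsub (measure_iUnion_null hnull)
  rw [ae_iff]
  exact hN

end Summit.QuantumFields.YangMills.Theorems.ColdStartUniversality

end
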